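import Summits.QuantumFields.QCD.Theses.WilsonQuarkChessboard

/-!
# Route WilsonQuarkChessboard — the glue `QuarkChessboard → FlatCellOptimal → QuarkDiamagnetism` and its converse

The route text (item stmt-QuantumFields-9310, "Glue") records that the sharp global corollary
`‖det_AP D_W[U]‖ ≤ Re det_AP D_W[𝟙]` (decl `QuarkDiamagnetism`) follows from the chessboard
domination `QuarkChessboard` (C) and the flat-cell optimum `FlatCellOptimal` (K): for every cell
`c`, `0 ≤ Re det_AP[R_c U] ≤ Re det_AP[𝟙]`, hence
`‖det_AP[U]‖ ^ (L⁴) ≤ ∏_c Re det_AP[R_c U] ≤ (Re det_AP[𝟙]) ^ (L⁴)` and one takes the `L⁴`-th root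
(there are `L⁴` cells `c : Site 4 L`).  This file proves exactly that implication; the mass window
is `min δ_K 1` (C needs `m > -1`, K needs `|m| < δ_K`).

Conversely `flatCellOptimal_of_quarkDiamagnetism : QuarkDiamagnetism → FlatCellOptimal` (a
reflection tiling is itself a gauge field and `Re z ≤ ‖z‖`), so that, granted C, the support item
is equivalent to the crux K up to the window.

This is a helper (`--supports stmt-QuantumFields-9310`): it does not close the item, whose two
hypotheses are the open cruxes stmt-QuantumFields-9306 (C) and stmt-QuantumFields-9307 (K).
-/

namespace Summit.QuantumFields.QCD.Theorems

open Summit.QuantumFields.QCD.Theses.WilsonQuarkChessboard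

/-- Root extraction behind the chessboard glue: if `0 ≤ a`, `0 ≤ f i ≤ b` for every `i` in a
finite index type of cardinality `n ≠ 0`, and `a ^ n ≤ ∏ i, f i`, then `a ≤ b`. -/
theorem wqcGlue_le_of_pow_card_le_prod {ι : Type*} [Fintype ι] {n : ℕ}
    (hn : Fintype.card ι = n) (hn0 : n ≠ 0) {a b : ℝ} {f : ι → ℝ} (ha : 0 ≤ a)
    (hf : ∀ i, 0 ≤ f i) (hfb : ∀ i, f i ≤ b) (h : a ^ n ≤ ∏ i, f i) : a ≤ b := by
  have hne : Nonempty ι := Fintype.card_pos_iff.mp (by omega)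
  obtain ⟨i₀⟩ := hne
  have hb : 0 ≤ b := (hf i₀).trans (hfb i₀)
  have hprod : ∏ i, f i ≤ b ^ n := by
    calc ∏ i, f i ≤ ∏ _i : ι, b := Finset.prod_le_prod (fun i _ => hf i) (fun i _ => hfb i)
      _ = b ^ n := by rw [Finset.prod_const, Finset.card_univ, hn]
  exact (pow_le_pow_iff_left₀ ha hb hn0).mp (h.trans hprod)

/-- The number of closed unit cells (= sites) of the four-torus of side `L` is `L ^ 4`. -/
theorem wqcGlue_card_site (L : ℕ) [NeZero L] :
    Fintype.card (Literature.MathematicalPhysics.QuantumFieldTheory.Site 4 L) = L ^ 4 := by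
  simp [ZMod.card]

/-- **Glue of item stmt-QuantumFields-9310.** The chessboard domination of the antiperiodic
Wilson–Dirac determinant (`QuarkChessboard`, C) together with the optimality of the flat cell
among period-2 reflection tilings near `κ = 1/8` (`FlatCellOptimal`, K, window `δ`) implies the
diamagnetic inequality for Wilson quarks (`QuarkDiamagnetism`) with window `min δ 1`:
`‖det_AP D_W[U]‖ ^ (L⁴) ≤ ∏_c Re det_AP D_W[R_c U] ≤ (Re det_AP D_W[𝟙]) ^ (L⁴)`, every factor being
`≥ 0` by C, and `L⁴`-th roots. -/
theorem quarkDiamagnetism_of_quarkChessboard_of_flatCellOptimal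
    (hC : QuarkChessboard) (hK : FlatCellOptimal) : QuarkDiamagnetism := by
  obtain ⟨δ, hδ, hK⟩ := hK
  refine ⟨min δ 1, lt_min hδ one_pos, ?_⟩
  intro N L _ hL h4 U m hm1 hm2
  have hmin1 : min δ 1 ≤ δ := min_le_left δ 1
  have hmin2 : min δ 1 ≤ 1 := min_le_right δ 1
  have hC' := hC N L hL h4 U m (by linarith)
  have hK' := fun c => hK N L hL h4 U c m (by linarith) (by linarith)
  dsimp only at hC' hK' ⊢
  obtain ⟨hpos, hprod⟩ := hC'
  exact wqcGlue_le_of_pow_card_le_prod (wqcGlue_card_site L) (pow_ne_zero 4 (NeZero.ne L))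
    (norm_nonneg _) (fun c => (hpos c).1) (fun c => hK' c) hprod

/-- **Converse direction of the glue: `QuarkDiamagnetism → FlatCellOptimal`.** Every period-2
reflection tiling `R_c U` is itself a `U(N)` gauge field, so the global diamagnetic inequality
applied to `R_c U` gives `Re det_AP[R_c U] ≤ ‖det_AP[R_c U]‖ ≤ Re det_AP[𝟙]` with the same mass
window.  Together with `quarkDiamagnetism_of_quarkChessboard_of_flatCellOptimal` this shows that,
granted the chessboard estimate `QuarkChessboard`, the support item `QuarkDiamagnetism` is
EQUIVALENT (up to shrinking the window to `min δ 1`) to the crux `FlatCellOptimal`: it is not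
easier than crux #3 of the route. -/
theorem flatCellOptimal_of_quarkDiamagnetism (hD : QuarkDiamagnetism) : FlatCellOptimal := by
  obtain ⟨δ, hδ, hD⟩ := hD
  refine ⟨δ, hδ, ?_⟩
  intro N L _ hL h4 U c m hm1 hm2
  have hD' := fun V => hD N L hL h4 V m hm1 hm2
  dsimp only at hD' ⊢
  exact (Complex.re_le_norm _).trans (hD' _)

end Summit.QuantumFields.QCD.Theorems
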